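import Summits.QuantumFields.GaugeBoot.EquipartitionLinkRule
import Summits.QuantumFields.GaugeBoot.HaarShiftPlaquetteSign
import HarnessLib

/-!
# Gauge-boot: QUANTITATIVE UNFREEZING — in every one-link Gibbs (DLR) state, at ANY real coupling, every single plaquette has
# `e^{−4(d−1)N|β|} ≤ 1 − ⟨u_P⟩` and `e^{−4(d−1)N|β|} ≤ 1 + ⟨u_P⟩`, with no symmetry assumed (large-`N` supplement 20, part 1)

HONEST FRAMING (cell `pub-gaugeboot`, page 1 of every file): certified bounds on lattice
expectations at STATED coupling, gauge group, dimension and torus size; NOT a mass gap, NOT a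
continuum limit, NOT a string tension; NOT Yang–Mills-summit-bearing (barriers `FixedCouplingUltralocality`,
`PerturbativeInvisibility`).  An explicit (exponentially small) a-priori gap; it certifies no number of CERTIFIED.md.

## Content

Supplement 16 proved `⟨W⟩ < 1` STRICTLY in every Haar-shift state (a support argument, no rate); supplement 19 gave the
equipartition gap `δ = (N² − 1)/(4(d−1)β_std + N² − 1)` for the AVERAGE of the `2(d−1)` plaquettes through a link (and plaquette
by plaquette only for symmetric states).  Here: a gap for EVERY SINGLE PLAQUETTE of EVERY Haar-shift state, at every real `β`,
from the one-link Gibbs identity alone.  `G` compact metrisable, `ρ` continuous without invariant vectors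
(`hρ0 : ∀ m, ∫ Re tr ρ(g m) dg = 0`), `μ` a probability measure with `IsHaarShiftState ρ β μ`:

* `abs_shiftAction_le` — `|S_e(U[e ↦ g⁻¹U_e]) − S_e(U)| ≤ 2N·#{p ∋ e}`; `card_plaquettesTouching_singleton` — `#{p ∋ e} = 2(d−1)`
  (the re-indexing lemma of `EquipartitionLinkRule`);
* ★ `IsHaarShiftState.integral_comp_update_le` — QUASI-INVARIANCE: for a non-negative continuous cylinder observable `f` and every
  `g`, `∫ f(U[e ↦ gU_e]) dμ ≤ e^{2N·#{p∋e}·|β|} ∫ f dμ`;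
* ★★ `IsHaarShiftState.integral_haarAvg_le` — averaging over `g` (Fubini): `∫ (∫ f(U[e ↦ gU_e]) dg) dμ ≤ e^{4(d−1)N|β|} ∫ f dμ`;
* `integral_haar_plaquetteObs_update_mul_eq_zero` — the Haar average over one of its links of a plaquette character vanishes
  (`HaarShiftPlaquetteAverage`, `g U_e` form);
* ★★★ `IsHaarShiftState.exp_le_one_sub_integral_plaquette` / `…_one_add_…` — for every plaquette `p`:
  **`e^{−4(d−1)N|β|} ≤ 1 − ∫ (1/N) Re tr ρ(U_p) dμ`** and **`e^{−4(d−1)N|β|} ≤ 1 + ∫ (1/N) Re tr ρ(U_p) dμ`**, i.e.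
  `|∫ u_p dμ| ≤ 1 − e^{−4(d−1)N|β|}`;
* ★★★ `exp_le_one_sub_integral_plaquette_of_mem_ymGibbsMeasures_suN` (+ `abs_…`) — `SU(N)`, `N ≥ 2`, every real `β`, EVERY DLR state,
  EVERY plaquette: `e^{−4(d−1)N|β|} ≤ 1 − ∫ u_P dμ` (cell normalisation `β = β_std/N`: `e^{−4(d−1)|β_std|}`).
[folklore] (quasi-invariance of Gibbs measures under local modifications, H.-O. Georgii, *Gibbs Measures and Phase Transitions* (2011)
§1.2–§2.1, made quantitative.)
-/

noncomputable section

open MeasureTheory Function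
open Literature.Probability.LatticeModels (Site)
open Literature.MathematicalPhysics.QuantumFieldTheory (haarProbability)
open Literature.MathematicalPhysics.QuantumLattice
open Literature.RepresentationTheory.CompactGroups

namespace Summit.QuantumFields.GaugeBoot

variable {d N : ℕ} {G : Type*} [Group G] [TopologicalSpace G] [IsTopologicalGroup G]
  [CompactSpace G] [MeasurableSpace G] [BorelSpace G] (ρ : G →* Matrix (Fin N) (Fin N) ℂ)

/-! ## The shift of the boundary action is bounded -/

section Bounds

omit [MeasurableSpace G] [BorelSpace G] in
/-- `0 ≤ S_e(U) ≤ 2N·#{p ∋ e}` for a continuous representation of a compact group (`|Re tr ρ| ≤ N`). [folklore] -/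
theorem wilsonBoundaryAction_mem_Icc (hρ : Continuous ρ) (e : ZdEdge d) (U : LGConfig d G) :
    0 ≤ wilsonBoundaryAction ρ {e} U ∧
      wilsonBoundaryAction ρ {e} U ≤ 2 * N * (plaquettesTouching ({e} : Finset (ZdEdge d))).card := by
  have hb : ∀ p : ZdPlaquette d, |plaquetteObs ρ p.1 p.2.1.1 p.2.1.2 U| ≤ N := fun p => by
    have h := CompactGroup.abs_re_trace_le_card ρ hρ (plaquetteHolonomyZd U p.1 p.2.1.1 p.2.1.2)
    rwa [Fintype.card_fin] at h
  unfold wilsonBoundaryAction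
  refine ⟨Finset.sum_nonneg fun p _ => ?_, ?_⟩
  · have := (abs_le.1 (hb p)).2
    linarith
  · calc ∑ p ∈ plaquettesTouching ({e} : Finset (ZdEdge d)), ((N : ℝ) - plaquetteObs ρ p.1 p.2.1.1 p.2.1.2 U)
        ≤ ∑ _p ∈ plaquettesTouching ({e} : Finset (ZdEdge d)), (2 * N : ℝ) :=
          Finset.sum_le_sum fun p _ => by have := (abs_le.1 (hb p)).1; linarith
      _ = 2 * N * (plaquettesTouching ({e} : Finset (ZdEdge d))).card := by
          rw [Finset.sum_const, nsmul_eq_mul]; ring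

omit [MeasurableSpace G] [BorelSpace G] in
/-- `|S_e(U[e ↦ h U_e]) − S_e(U)| ≤ 2N·#{p ∋ e}`. [folklore] -/
theorem abs_shiftAction_le (hρ : Continuous ρ) (e : ZdEdge d) (h : G) (U : LGConfig d G) :
    |wilsonBoundaryAction ρ {e} (Function.update U e (h * U e)) - wilsonBoundaryAction ρ {e} U| ≤
      2 * N * (plaquettesTouching ({e} : Finset (ZdEdge d))).card := by
  have h1 := wilsonBoundaryAction_mem_Icc ρ hρ e (Function.update U e (h * U e))
  have h2 := wilsonBoundaryAction_mem_Icc ρ hρ e U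
  rw [abs_le]
  constructor <;> linarith [h1.1, h1.2, h2.1, h2.2]

/-- `#{p ∋ (x, a)} = 2(d−1)`: the plaquettes through a link (re-indexing lemma of `EquipartitionLinkRule`). [folklore] -/
theorem card_plaquettesTouching_singleton (x : Site d) (a : Fin d) :
    (plaquettesTouching ({(x, a)} : Finset (ZdEdge d))).card = 2 * (d - 1) := by
  have h := EquipartitionZd.sum_plaquettesTouching_eq_sum_erase x a (fun _ _ _ => (1 : ℕ)) (fun _ _ _ => rfl)
  rw [Finset.card_eq_sum_ones, h, Finset.sum_const, Finset.card_erase_of_mem (Finset.mem_univ a), Finset.card_univ,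
    Fintype.card_fin, smul_eq_mul]
  omega

/-- The exponent: `2N·#{p ∋ e}·|β| = 4(d−1)N|β|`. [folklore] -/
theorem shiftExponent_eq (e : ZdEdge d) (β : ℝ) :
    |β| * (2 * N * (plaquettesTouching ({e} : Finset (ZdEdge d))).card) = 4 * ((d - 1 : ℕ) : ℝ) * N * |β| := by
  obtain ⟨x, a⟩ := e
  rw [card_plaquettesTouching_singleton, Nat.cast_mul, Nat.cast_ofNat]
  ring

end Bounds

/-! ## Quasi-invariance of a Haar-shift state under one-link shifts -/

section Quasi

variable [SecondCountableTopology G]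

/-- ★ **QUASI-INVARIANCE**: for a Haar-shift state `μ` (any real `β`), a non-negative continuous cylinder observable `f`, a link
`e` and `g ∈ G`: `∫ f(U[e ↦ gU_e]) dμ ≤ e^{|β|·2N·#{p∋e}} · ∫ f dμ`. [folklore] -/
theorem IsHaarShiftState.integral_comp_update_le (hρ : Continuous ρ) {β : ℝ} {μ : Measure (LGConfig d G)}
    [IsFiniteMeasure μ] (hμ : IsHaarShiftState ρ β μ) {f : LGConfig d G → ℝ} {S : Finset (ZdEdge d)}
    (hS : IsCylinder f S) (hf : Continuous f) (hf0 : ∀ U, 0 ≤ f U) (e : ZdEdge d) (g : G) :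
    ∫ U, f (Function.update U e (g * U e)) ∂μ ≤
      Real.exp (|β| * (2 * N * (plaquettesTouching ({e} : Finset (ZdEdge d))).card)) * ∫ U, f U ∂μ := by
  rw [hμ e g f S hS hf, ← integral_const_mul]
  refine integral_mono_of_nonneg (ae_of_all _ fun U => mul_nonneg (hf0 U) (Real.exp_nonneg _)) ?_
    (ae_of_all _ fun U => ?_)
  · exact (integrable_of_continuous_real hf μ).const_mul _
  · -- pointwise: `f·e^{−βΔ} ≤ e^{|β|K}·f`
    have hΔ := abs_shiftAction_le ρ hρ e g⁻¹ U
    have hexp : Real.exp (-(β * (wilsonBoundaryAction ρ {e} (Function.update U e (g⁻¹ * U e)) -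
        wilsonBoundaryAction ρ {e} U))) ≤
        Real.exp (|β| * (2 * N * (plaquettesTouching ({e} : Finset (ZdEdge d))).card)) := by
      refine Real.exp_le_exp.2 ?_
      have h1 : -(β * (wilsonBoundaryAction ρ {e} (Function.update U e (g⁻¹ * U e)) - wilsonBoundaryAction ρ {e} U)) ≤
          |β| * |wilsonBoundaryAction ρ {e} (Function.update U e (g⁻¹ * U e)) - wilsonBoundaryAction ρ {e} U| := by
        rw [← abs_mul]; exact neg_le_abs _
      exact h1.trans (mul_le_mul_of_nonneg_left hΔ (abs_nonneg β))
    calc f U * Real.exp (-(β * (wilsonBoundaryAction ρ {e} (Function.update U e (g⁻¹ * U e)) -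
          wilsonBoundaryAction ρ {e} U))) ≤ f U * Real.exp (|β| * (2 * N * (plaquettesTouching ({e} : Finset (ZdEdge d))).card)) :=
        mul_le_mul_of_nonneg_left hexp (hf0 U)
      _ = _ := mul_comm _ _

omit [CompactSpace G] [MeasurableSpace G] [BorelSpace G] [SecondCountableTopology G] in
/-- Joint continuity of `(g, U) ↦ f(U[e ↦ gU_e])`. [folklore] -/
theorem continuous_comp_update_uncurry {f : LGConfig d G → ℝ} (hf : Continuous f) (e : ZdEdge d) :
    Continuous fun q : G × LGConfig d G => f (Function.update q.2 e (q.1 * q.2 e)) := by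
  have hupd : Continuous fun q : G × LGConfig d G => Function.update q.2 e (q.1 * q.2 e) := by
    refine continuous_pi fun x => ?_
    by_cases hx : x = e
    · subst hx
      simp only [Function.update_self]
      exact continuous_fst.mul ((continuous_apply x).comp continuous_snd)
    · simp only [Function.update_of_ne hx]
      exact (continuous_apply x).comp continuous_snd
  exact hf.comp hupd

/-- **Fubini for the Haar average over one link.** [folklore] -/
theorem integral_integral_comp_update_swap {f : LGConfig d G → ℝ} (hf : Continuous f) (μ : Measure (LGConfig d G))
    [IsFiniteMeasure μ] (e : ZdEdge d) :
    ∫ U, (∫ g, f (Function.update U e (g * U e)) ∂(haarProbability G)) ∂μ =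
      ∫ g, (∫ U, f (Function.update U e (g * U e)) ∂μ) ∂(haarProbability G) := by
  have hc := continuous_comp_update_uncurry hf e
  obtain ⟨C, hC⟩ := isCompact_univ.exists_bound_of_continuousOn hc.continuousOn
  have hint : Integrable (uncurry fun (g : G) (U : LGConfig d G) => f (Function.update U e (g * U e)))
      ((haarProbability G).prod μ) :=
    Integrable.of_bound hc.aestronglyMeasurable C (ae_of_all _ fun q => hC q (Set.mem_univ _))
  exact (integral_integral_swap hint).symm

/-- ★★ **THE HAAR-AVERAGED QUASI-INVARIANCE**: `∫ (∫ f(U[e ↦ gU_e]) dg) dμ ≤ e^{|β|·2N·#{p∋e}} ∫ f dμ` for every non-negative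
continuous cylinder observable. [folklore] -/
theorem IsHaarShiftState.integral_haarAvg_le (hρ : Continuous ρ) {β : ℝ} {μ : Measure (LGConfig d G)}
    [IsFiniteMeasure μ] (hμ : IsHaarShiftState ρ β μ) {f : LGConfig d G → ℝ} {S : Finset (ZdEdge d)}
    (hS : IsCylinder f S) (hf : Continuous f) (hf0 : ∀ U, 0 ≤ f U) (e : ZdEdge d) :
    ∫ U, (∫ g, f (Function.update U e (g * U e)) ∂(haarProbability G)) ∂μ ≤
      Real.exp (|β| * (2 * N * (plaquettesTouching ({e} : Finset (ZdEdge d))).card)) * ∫ U, f U ∂μ := by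
  rw [integral_integral_comp_update_swap hf μ e]
  have hc := continuous_comp_update_uncurry hf e
  obtain ⟨C, hC⟩ := isCompact_univ.exists_bound_of_continuousOn hc.continuousOn
  have hint : Integrable (uncurry fun (g : G) (U : LGConfig d G) => f (Function.update U e (g * U e)))
      ((haarProbability G).prod μ) :=
    Integrable.of_bound hc.aestronglyMeasurable C (ae_of_all _ fun q => hC q (Set.mem_univ _))
  calc ∫ g, (∫ U, f (Function.update U e (g * U e)) ∂μ) ∂(haarProbability G)
      ≤ ∫ _g, Real.exp (|β| * (2 * N * (plaquettesTouching ({e} : Finset (ZdEdge d))).card)) * ∫ U, f U ∂μ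
          ∂(haarProbability G) :=
        integral_mono hint.integral_prod_left (integrable_const _)
          fun g => hμ.integral_comp_update_le ρ hρ hS hf hf0 e g
    _ = Real.exp (|β| * (2 * N * (plaquettesTouching ({e} : Finset (ZdEdge d))).card)) * ∫ U, f U ∂μ := by
        rw [integral_const, probReal_univ, one_smul]

/-- ★★ **Consequence for observables with constant Haar average**: if `∫ f(U[e ↦ gU_e]) dg = c` for every `U` and `μ` is a
probability Haar-shift state, then `c ≤ e^{|β|·2N·#{p∋e}} ∫ f dμ`. [folklore] -/
theorem IsHaarShiftState.le_exp_mul_integral_of_haarAvg_eq (hρ : Continuous ρ) {β : ℝ} {μ : Measure (LGConfig d G)}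
    [IsProbabilityMeasure μ] (hμ : IsHaarShiftState ρ β μ) {f : LGConfig d G → ℝ} {S : Finset (ZdEdge d)}
    (hS : IsCylinder f S) (hf : Continuous f) (hf0 : ∀ U, 0 ≤ f U) (e : ZdEdge d) {c : ℝ}
    (havg : ∀ U, ∫ g, f (Function.update U e (g * U e)) ∂(haarProbability G) = c) :
    c ≤ Real.exp (|β| * (2 * N * (plaquettesTouching ({e} : Finset (ZdEdge d))).card)) * ∫ U, f U ∂μ := by
  have h := hμ.integral_haarAvg_le ρ hρ hS hf hf0 e
  simp only [havg, integral_const, probReal_univ, one_smul] at h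
  exact h

end Quasi

/-! ## Plaquettes -/

section Plaquette

variable [SecondCountableTopology G]

omit [SecondCountableTopology G] in
/-- The Haar average over one of its links of a plaquette character vanishes (`g U_e` form of
`integral_haar_plaquetteObs_update_eq_zero`). [folklore] -/
theorem integral_haar_plaquetteObs_update_mul_eq_zero
    (hρ0 : ∀ m : G, ∫ g, ((ρ (g * m)).trace).re ∂(haarProbability G) = 0) (p : ZdPlaquette d)
    {e : ZdEdge d} (he : e ∈ plaquetteEdges p) (U : LGConfig d G) :
    ∫ g, plaquetteObs ρ p.1 p.2.1.1 p.2.1.2 (Function.update U e (g * U e)) ∂(haarProbability G) = 0 := by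
  have h := integral_inv_eq_self (fun g => plaquetteObs ρ p.1 p.2.1.1 p.2.1.2 (Function.update U e (g * U e)))
    (haarProbability G)
  rw [← h]
  exact integral_haar_plaquetteObs_update_eq_zero ρ hρ0 p he U

/-- The first edge of a plaquette. [folklore] -/
theorem fst_mem_plaquetteEdges (p : ZdPlaquette d) : (p.1, p.2.1.1) ∈ plaquetteEdges p := by
  simp [plaquetteEdges]

/-- ★★★ **QUANTITATIVE UNFREEZING, UPPER SIDE**: for a probability Haar-shift state `μ` at ANY real `β` (continuous `ρ` without
invariant vectors, `N ≥ 1`) and EVERY plaquette `p`: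
`e^{−|β|·2N·#{q ∋ e_p}} ≤ 1 − ∫ (1/N) Re tr ρ(U_p) dμ` (`e_p` the first edge of `p`; the exponent is `4(d−1)N|β|`). [folklore] -/
theorem IsHaarShiftState.exp_le_one_sub_integral_plaquette (hρ : Continuous ρ) (hN : N ≠ 0)
    (hρ0 : ∀ m : G, ∫ g, ((ρ (g * m)).trace).re ∂(haarProbability G) = 0) {β : ℝ} {μ : Measure (LGConfig d G)}
    [IsProbabilityMeasure μ] (hμ : IsHaarShiftState ρ β μ) (p : ZdPlaquette d) :
    Real.exp (-(|β| * (2 * N * (plaquettesTouching ({(p.1, p.2.1.1)} : Finset (ZdEdge d))).card))) ≤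
      1 - ∫ U, (N : ℝ)⁻¹ * plaquetteObs ρ p.1 p.2.1.1 p.2.1.2 U ∂μ := by
  set e : ZdEdge d := (p.1, p.2.1.1) with he
  set f : LGConfig d G → ℝ := fun U => 1 - (N : ℝ)⁻¹ * plaquetteObs ρ p.1 p.2.1.1 p.2.1.2 U with hf
  have hNpos : (0 : ℝ) < N := by exact_mod_cast Nat.pos_of_ne_zero hN
  have hPc : Continuous fun U : LGConfig d G => plaquetteObs ρ p.1 p.2.1.1 p.2.1.2 U := continuous_plaquetteObs ρ hρ _ _ _
  have hfc : Continuous f := continuous_const.sub (continuous_const.mul hPc)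
  have hS : IsCylinder f (plaquetteEdges p) := by
    intro U V hUV
    simp only [hf, isCylinder_plaquetteObs ρ p hUV]
  have hf0 : ∀ U, 0 ≤ f U := fun U => by
    have hb := CompactGroup.abs_re_trace_le_card ρ hρ (plaquetteHolonomyZd U p.1 p.2.1.1 p.2.1.2)
    rw [Fintype.card_fin] at hb
    have h1 : (N : ℝ)⁻¹ * plaquetteObs ρ p.1 p.2.1.1 p.2.1.2 U ≤ 1 := by
      rw [inv_mul_le_iff₀ hNpos, mul_one]
      exact (le_abs_self _).trans hb
    simp only [hf]; linarith
  have havg : ∀ U, ∫ g, f (Function.update U e (g * U e)) ∂(haarProbability G) = 1 := by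
    intro U
    simp only [hf]
    rw [integral_sub (integrable_const _) ?_, integral_const, probReal_univ, one_smul, integral_const_mul,
      integral_haar_plaquetteObs_update_mul_eq_zero ρ hρ0 p (fst_mem_plaquetteEdges p) U, mul_zero, sub_zero]
    have hcg : Continuous fun g : G => (N : ℝ)⁻¹ * plaquetteObs ρ p.1 p.2.1.1 p.2.1.2 (Function.update U e (g * U e)) :=
      continuous_const.mul (hPc.comp (by
        refine continuous_pi fun x => ?_
        by_cases hx : x = e
        · subst hx; simp only [Function.update_self]; exact continuous_id.mul continuous_const
        · simp only [Function.update_of_ne hx]; exact continuous_const))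
    exact hcg.integrable_of_hasCompactSupport (HasCompactSupport.of_compactSpace _)
  have h := hμ.le_exp_mul_integral_of_haarAvg_eq ρ hρ hS hfc hf0 e havg
  have hint : ∫ U, f U ∂μ = 1 - ∫ U, (N : ℝ)⁻¹ * plaquetteObs ρ p.1 p.2.1.1 p.2.1.2 U ∂μ := by
    simp only [hf]
    rw [integral_sub (integrable_const _) ((integrable_of_continuous_real hPc μ).const_mul _), integral_const, probReal_univ,
      one_smul]
  rw [hint] at h
  have hK := Real.exp_pos (|β| * (2 * N * (plaquettesTouching ({e} : Finset (ZdEdge d))).card))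
  rw [Real.exp_neg, inv_le_iff_one_le_mul₀ hK]
  linarith [h]

/-- ★★★ **QUANTITATIVE UNFREEZING, LOWER SIDE**: `e^{−|β|·2N·#{q ∋ e_p}} ≤ 1 + ∫ (1/N) Re tr ρ(U_p) dμ`. [folklore] -/
theorem IsHaarShiftState.exp_le_one_add_integral_plaquette (hρ : Continuous ρ) (hN : N ≠ 0)
    (hρ0 : ∀ m : G, ∫ g, ((ρ (g * m)).trace).re ∂(haarProbability G) = 0) {β : ℝ} {μ : Measure (LGConfig d G)}
    [IsProbabilityMeasure μ] (hμ : IsHaarShiftState ρ β μ) (p : ZdPlaquette d) :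
    Real.exp (-(|β| * (2 * N * (plaquettesTouching ({(p.1, p.2.1.1)} : Finset (ZdEdge d))).card))) ≤
      1 + ∫ U, (N : ℝ)⁻¹ * plaquetteObs ρ p.1 p.2.1.1 p.2.1.2 U ∂μ := by
  set e : ZdEdge d := (p.1, p.2.1.1) with he
  set f : LGConfig d G → ℝ := fun U => 1 + (N : ℝ)⁻¹ * plaquetteObs ρ p.1 p.2.1.1 p.2.1.2 U with hf
  have hNpos : (0 : ℝ) < N := by exact_mod_cast Nat.pos_of_ne_zero hN
  have hPc : Continuous fun U : LGConfig d G => plaquetteObs ρ p.1 p.2.1.1 p.2.1.2 U := continuous_plaquetteObs ρ hρ _ _ _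
  have hfc : Continuous f := continuous_const.add (continuous_const.mul hPc)
  have hS : IsCylinder f (plaquetteEdges p) := by
    intro U V hUV
    simp only [hf, isCylinder_plaquetteObs ρ p hUV]
  have hf0 : ∀ U, 0 ≤ f U := fun U => by
    have hb := CompactGroup.abs_re_trace_le_card ρ hρ (plaquetteHolonomyZd U p.1 p.2.1.1 p.2.1.2)
    rw [Fintype.card_fin] at hb
    have h1 : -1 ≤ (N : ℝ)⁻¹ * plaquetteObs ρ p.1 p.2.1.1 p.2.1.2 U := by
      rw [← neg_le_neg_iff, neg_neg, ← mul_neg, inv_mul_le_iff₀ hNpos, mul_one]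
      exact (neg_le_abs _).trans hb
    simp only [hf]; linarith
  have havg : ∀ U, ∫ g, f (Function.update U e (g * U e)) ∂(haarProbability G) = 1 := by
    intro U
    simp only [hf]
    rw [integral_add (integrable_const _) ?_, integral_const, probReal_univ, one_smul, integral_const_mul,
      integral_haar_plaquetteObs_update_mul_eq_zero ρ hρ0 p (fst_mem_plaquetteEdges p) U, mul_zero, add_zero]
    have hcg : Continuous fun g : G => (N : ℝ)⁻¹ * plaquetteObs ρ p.1 p.2.1.1 p.2.1.2 (Function.update U e (g * U e)) :=
      continuous_const.mul (hPc.comp (by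
        refine continuous_pi fun x => ?_
        by_cases hx : x = e
        · subst hx; simp only [Function.update_self]; exact continuous_id.mul continuous_const
        · simp only [Function.update_of_ne hx]; exact continuous_const))
    exact hcg.integrable_of_hasCompactSupport (HasCompactSupport.of_compactSpace _)
  have h := hμ.le_exp_mul_integral_of_haarAvg_eq ρ hρ hS hfc hf0 e havg
  have hint : ∫ U, f U ∂μ = 1 + ∫ U, (N : ℝ)⁻¹ * plaquetteObs ρ p.1 p.2.1.1 p.2.1.2 U ∂μ := by
    simp only [hf]
    rw [integral_add (integrable_const _) ((integrable_of_continuous_real hPc μ).const_mul _), integral_const, probReal_univ,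
      one_smul]
  rw [hint] at h
  have hK := Real.exp_pos (|β| * (2 * N * (plaquettesTouching ({e} : Finset (ZdEdge d))).card))
  rw [Real.exp_neg, inv_le_iff_one_le_mul₀ hK]
  linarith [h]

end Plaquette

/-! ## `SU(N)`: every DLR state, every plaquette, every real `β` -/

section SuN

/-- ★★★ **QUANTITATIVE UNFREEZING FOR `SU(N)` GIBBS STATES.**  `N ≥ 2`, any `d`, ANY real `β` (tree coupling), `μ ∈ 𝒢(β)` any
DLR state of `SU(N)` lattice Yang–Mills on `ℤ^d`, `p` ANY plaquette (no symmetry of `μ` assumed):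
`e^{−4(d−1)N|β|} ≤ 1 − ∫ (1/N) Re tr U_p dμ`. [folklore] -/
theorem exp_le_one_sub_integral_plaquette_of_mem_ymGibbsMeasures_suN {d N : ℕ} (hN : 2 ≤ N) {β : ℝ}
    {μ : Measure (LGConfig d (Matrix.specialUnitaryGroup (Fin N) ℂ))}
    (hμ : μ ∈ ymGibbsMeasures (d := d) (fundamentalRep (Fin N)) β) (p : ZdPlaquette d) :
    Real.exp (-(4 * ((d - 1 : ℕ) : ℝ) * N * |β|)) ≤ 1 - ∫ U, (N : ℝ)⁻¹ * plaquetteObs (fundamentalRep (Fin N)) p.1 p.2.1.1 p.2.1.2 U ∂μ := by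
  haveI : SecondCountableTopology (Matrix (Fin N) (Fin N) ℂ) :=
    inferInstanceAs (SecondCountableTopology (Fin N → Fin N → ℂ))
  haveI : SecondCountableTopology (Matrix.specialUnitaryGroup (Fin N) ℂ) :=
    Topology.IsEmbedding.subtypeVal.secondCountableTopology
  have hG : Literature.Probability.LatticeModels.IsGibbsMeasure (ymSpecification (fundamentalRep (Fin N)) β) μ := hμ
  haveI := hG.isProbabilityMeasure
  obtain ⟨z, ζ, hζ1, hz, -⟩ :=
    Literature.MathematicalPhysics.QuantumFieldTheory.IsSpecialUnitaryModel.exists_central (fundamentalRep (Fin N))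
      (Literature.MathematicalPhysics.QuantumFieldTheory.TorusAreaLaw.isSpecialUnitaryModel_fundamentalRep N) hN
  have hρ0 := integral_re_trace_mul_eq_zero_of_smul_one (fundamentalRep (Fin N)) (continuous_fundamentalRep (Fin N)) hz hζ1
  have h := (isHaarShiftState_of_mem_ymGibbsMeasures (fundamentalRep (Fin N)) (continuous_fundamentalRep _) hμ)
    |>.exp_le_one_sub_integral_plaquette (fundamentalRep (Fin N)) (continuous_fundamentalRep _) (by omega) hρ0 p
  rwa [shiftExponent_eq] at h

/-- ★★★ The lower side for `SU(N)` Gibbs states: `e^{−4(d−1)N|β|} ≤ 1 + ∫ (1/N) Re tr U_p dμ`. [folklore] -/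
theorem exp_le_one_add_integral_plaquette_of_mem_ymGibbsMeasures_suN {d N : ℕ} (hN : 2 ≤ N) {β : ℝ}
    {μ : Measure (LGConfig d (Matrix.specialUnitaryGroup (Fin N) ℂ))}
    (hμ : μ ∈ ymGibbsMeasures (d := d) (fundamentalRep (Fin N)) β) (p : ZdPlaquette d) :
    Real.exp (-(4 * ((d - 1 : ℕ) : ℝ) * N * |β|)) ≤ 1 + ∫ U, (N : ℝ)⁻¹ * plaquetteObs (fundamentalRep (Fin N)) p.1 p.2.1.1 p.2.1.2 U ∂μ := by
  haveI : SecondCountableTopology (Matrix (Fin N) (Fin N) ℂ) :=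
    inferInstanceAs (SecondCountableTopology (Fin N → Fin N → ℂ))
  haveI : SecondCountableTopology (Matrix.specialUnitaryGroup (Fin N) ℂ) :=
    Topology.IsEmbedding.subtypeVal.secondCountableTopology
  have hG : Literature.Probability.LatticeModels.IsGibbsMeasure (ymSpecification (fundamentalRep (Fin N)) β) μ := hμ
  haveI := hG.isProbabilityMeasure
  obtain ⟨z, ζ, hζ1, hz, -⟩ :=
    Literature.MathematicalPhysics.QuantumFieldTheory.IsSpecialUnitaryModel.exists_central (fundamentalRep (Fin N))
      (Literature.MathematicalPhysics.QuantumFieldTheory.TorusAreaLaw.isSpecialUnitaryModel_fundamentalRep N) hN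
  have hρ0 := integral_re_trace_mul_eq_zero_of_smul_one (fundamentalRep (Fin N)) (continuous_fundamentalRep (Fin N)) hz hζ1
  have h := (isHaarShiftState_of_mem_ymGibbsMeasures (fundamentalRep (Fin N)) (continuous_fundamentalRep _) hμ)
    |>.exp_le_one_add_integral_plaquette (fundamentalRep (Fin N)) (continuous_fundamentalRep _) (by omega) hρ0 p
  rwa [shiftExponent_eq] at h

/-- ★★★ Two-sided: `|∫ u_P dμ| ≤ 1 − e^{−4(d−1)N|β|}` for every DLR state of `SU(N)` and every plaquette. [folklore] -/
theorem abs_integral_plaquette_le_of_mem_ymGibbsMeasures_suN {d N : ℕ} (hN : 2 ≤ N) {β : ℝ}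
    {μ : Measure (LGConfig d (Matrix.specialUnitaryGroup (Fin N) ℂ))}
    (hμ : μ ∈ ymGibbsMeasures (d := d) (fundamentalRep (Fin N)) β) (p : ZdPlaquette d) :
    |∫ U, (N : ℝ)⁻¹ * plaquetteObs (fundamentalRep (Fin N)) p.1 p.2.1.1 p.2.1.2 U ∂μ| ≤
      1 - Real.exp (-(4 * ((d - 1 : ℕ) : ℝ) * N * |β|)) := by
  have h1 := exp_le_one_sub_integral_plaquette_of_mem_ymGibbsMeasures_suN hN hμ p
  have h2 := exp_le_one_add_integral_plaquette_of_mem_ymGibbsMeasures_suN hN hμ p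
  rw [abs_le]
  constructor <;> linarith

/-- **Cell normalisation** (`β = β_std/N`): the gap is `e^{−4(d−1)|β_std|}`: `e^{−4(d−1)|β_std|} ≤ 1 − ∫ u_P dμ` for every DLR
state of `SU(N)` at `β_std` and every plaquette. [folklore] -/
theorem exp_le_one_sub_integral_plaquette_of_mem_ymGibbsMeasures_suN_std {d N : ℕ} (hN : 2 ≤ N) {β : ℝ}
    {μ : Measure (LGConfig d (Matrix.specialUnitaryGroup (Fin N) ℂ))}
    (hμ : μ ∈ ymGibbsMeasures (d := d) (fundamentalRep (Fin N)) (β / N)) (p : ZdPlaquette d) :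
    Real.exp (-(4 * ((d - 1 : ℕ) : ℝ) * |β|)) ≤ 1 - ∫ U, (N : ℝ)⁻¹ * plaquetteObs (fundamentalRep (Fin N)) p.1 p.2.1.1 p.2.1.2 U ∂μ := by
  have h := exp_le_one_sub_integral_plaquette_of_mem_ymGibbsMeasures_suN hN hμ p
  have hN0 : (0 : ℝ) < N := by exact_mod_cast (by omega : 0 < N)
  have he : 4 * ((d - 1 : ℕ) : ℝ) * N * |β / N| = 4 * ((d - 1 : ℕ) : ℝ) * |β| := by
    rw [abs_div, abs_of_pos hN0]; field_simp
  rwa [he] at h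

end SuN

end Summit.QuantumFields.GaugeBoot

end
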